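import Mathlib
import HarnessLib
import Summits.HubbardSuperconductivity.HubbardSuperconductivity.Theorems.KLProgrammeKLRegimeEngineTowerBlockIncrLevOrientedF
import Summits.HubbardSuperconductivity.HubbardSuperconductivity.Theorems.KLProgrammeKLRegimeEngineTowerBlockIncrLevOrientedKitGeneric

/-!
# LINK-F (i)–(iii) ON THE PIN-CREDITED INSTANCE — the oriented kit form with the floor arrays CONCRETE (`c = 9`)
# (crux K3 ENGINE, stmt-HubbardSuperconductivity-20437 `KLRegimeEngineV17F2`, stub (b) v2, levels package (ℓ), located items #10 / #16; pen (R301) re-cut;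
#  cell gate-hubbard-kl, seat hubbard-kl-k3c3-p2 g15 — E1 / the LINK-F lane may rename or supersede)

k3c2-p3 g14's `…TowerBlockIncrLevOrientedF.doorSum_klTowerIncr_le_orientedF9` (p680387) is the oriented door form on the tower's own increment, keyed on the
pin-CREDITED input rows, with (I3) DISCHARGED: graded sizes `Bm m := ε·klTowerMuLevF … d k m·klLevUnitF β M 0 m (dk−1)/27`, floor ratio
`θ := (1/2)^{dk−1}`, full-pin family `B m c := (c = 0 ? klTowerMeasLev (2m) 0 : klTowerMeasLev (2m) (c+1))`.  This file feeds it to the generic kit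
composition `klLevNormOf_le_kit_oriented_of_doorForm_at` (this seat, p680457/p680605):

* §1 `klTowerMuLevAtF_degree_zero`, `klTowerMuLevF_degree_zero` (`klTowerMuLevF … d k 0 = 0`: no pattern of length `0` has a positive level), the
  `Bm 0 = 0` / `Bm ≥ 0` rows of the floor array;
* §2 **`klLevNormOf_klTowerIncr_le_kit_orientedF9`** — for `1 ≤ d`, `1 ≤ k`, `2 ≤ dk`, `dk ≤ J′`, `Z^K_{Λ_{dk}} ≠ 0`, the unweighted block constants, a
  track-blind tail majorant `Nt` (`ε·klTowerMeasLev (2m) 0 ≤ Nt m`, `Nt 0 = 0`), a first-order majorant `NF` asked at the two levels `|J_p| ∈ {F−1, F}` only,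
  kit parameters `τ, ψ`, kit guard `e·9α/κ²·towerV D τ Nt < 1`: for EVERY prescription `Ωe` of level `F`,
  `klLevNormOf … J′ (2(q+1)) Δ_k Ωe ≤ ε^{2q+1}·(cr·cc^{2q+1}·(27^F·(((1/2)^{dk−1})^{lumps F}·S + T)) + cr·cc^{2q+1}·((e²)^{q+2}/2·towerFO D κ² NF (q+1)))`
  with `S = Σ_{n∈[2,N₀−1]} e·Φ^{n−1}·ψ^{q+1}·towerS D τ (m ↦ ε·klTowerMuLevF d k m·klLevUnitF β M 0 m (dk−1)/27) n (q+1)`, `Φ = e·9α/κ²`,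
  `T = ψ^{q+1}·e·V·(ΦV)^{N₀−1}/(1−ΦV)`, `V = towerV D τ Nt`;
* §3 **`klTowerBornLev_le_kit_orientedF9`** — the `ciSup` row at `J′ = dk`, every level `F`.
What is left (pen (R301)): the unit-algebra floor twin «(ℓ)-LINK-UNIFORM-F» (divide by `klLevUnitF β M t p (dk)`, `F = t+1`; k3c2-p3 g14) and the law
rethread (p4 g20).  Compositions of landed theorems; nothing about the model is asserted beyond them; nothing asserts (ℓ), any stub, K3 or superconductivity.
References: BGM 2006 §2.7 (2.71a), §2.8 (2.76)–(2.84), (2.88)–(2.90), (2.97)–(2.98), §3 (3.2)–(3.8), App. A4 [cite: BenfattoGiulianiMastropietro2006].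
-/

noncomputable section

namespace Summit.HubbardSuperconductivity.HubbardSuperconductivity.Theorems.EngineV8

set_option linter.dupNamespace false -- summit = problem name (single-conjunct summit), D-0017

open Classical
open Real Finset Literature.MathematicalPhysics.QuantumLattice Literature.Probability.LatticeModels GrassmannAlgebra
open Literature.MathematicalPhysics.QuantumLattice.FermiRG Literature.MathematicalPhysics.QuantumLattice.FermiRG.BGM2006Routing
open Summit.HubbardSuperconductivity.HubbardSuperconductivity.Theorems.KLProgrammeLegKernels
open Summit.HubbardSuperconductivity.HubbardSuperconductivity.Theorems.KLRegimeSplit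
open Summit.HubbardSuperconductivity.HubbardSuperconductivity.Theorems.KLRegimeWick
open Summit.HubbardSuperconductivity.HubbardSuperconductivity.Theorems.TwoPointAssembly
open Summit.HubbardSuperconductivity.HubbardSuperconductivity.Theorems.DispersionFlow
open scoped Nat

variable {L M : ℕ} [NeZero L]

/-! ## §1 The floor array vanishes in degree `0` -/

/-- In degree `0` every track of the measured floor array vanishes: no pattern of length `0` has level `t + 1 ≥ 1`. -/
theorem klTowerMuLevAtF_degree_zero (β U μ : ℝ) (K : TrigPolyC4v) (d : ℕ) (t : Fin 5) (k : ℕ) :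
    klTowerMuLevAtF L M β U μ K d t k 0 = 0 := by
  have h0 : klTowerMeasLev L M β U μ K d k (2 * 0) ((t : ℕ) + 1) = 0 := by
    unfold klTowerMeasLev
    haveI : IsEmpty {Ωe : Fin (2 * 0) → Option (SectorLeg (sectorCount (d * k - 1))) // levelCount Ωe = (t : ℕ) + 1} := by
      refine ⟨fun Ωe => ?_⟩
      have h : levelCount Ωe.1 ≤ 2 * 0 := by
        unfold levelCount
        exact (card_le_univ _).trans_eq (Fintype.card_fin _)
      have := Ωe.2
      omega
    exact Real.iSup_of_isEmpty _
  unfold klTowerMuLevAtF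
  rw [h0, mul_zero, zero_div]

/-- **`klTowerMuLevF … d k 0 = 0`**: the track-blind measured floor array vanishes in degree `0`. -/
theorem klTowerMuLevF_degree_zero (β U μ : ℝ) (K : TrigPolyC4v) (d k : ℕ) : klTowerMuLevF L M β U μ K d k 0 = 0 := by
  unfold klTowerMuLevF
  simp only [klTowerMuLevAtF_degree_zero, sup'_const]

/-- The graded floor array of the re-keyed instance vanishes in degree `0`. -/
theorem towerBmF_zero (β U μ : ℝ) (K : TrigPolyC4v) (d k : ℕ) :
    (fun m : ℕ => imagTimeWeight β M * klTowerMuLevF L M β U μ K d k m * klLevUnitF β M 0 m (d * k - 1) / 27) 0 = 0 := by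
  simp only [klTowerMuLevF_degree_zero, mul_zero, zero_mul, zero_div]

/-- The graded floor array of the re-keyed instance is nonnegative (`0 < β`). -/
theorem towerBmF_nonneg [NeZero M] {β : ℝ} (hβ : 0 < β) (U μ : ℝ) (K : TrigPolyC4v) (d k m : ℕ) :
    0 ≤ (fun m : ℕ => imagTimeWeight β M * klTowerMuLevF L M β U μ K d k m * klLevUnitF β M 0 m (d * k - 1) / 27) m :=
  div_nonneg (mul_nonneg (mul_nonneg (imagTimeWeight_nonneg hβ.le M) (klTowerMuLevF_nonneg hβ U μ K d k m))
    (klLevUnitF_pos hβ 0 m _).le) (by norm_num)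

/-! ## §2 Every levelled norm of `Δ_k` in kit form, floor arrays concrete -/

section Born

variable [NeZero M]

/-- **THE ORIENTED LEVELLED NORMS OF A BLOCK INCREMENT IN KIT FORM, PIN-CREDITED, FLOOR ARRAYS CONCRETE, EVERY PRESCRIPTION.**  `1 ≤ d`, `1 ≤ k`,
`2 ≤ dk`, `dk ≤ J′`, `Z^K_{Λ_{dk}} ≠ 0`; UNWEIGHTED block constants (Gram `κ`, rows/cols `α` of `S(F̃)ᵀΓS(F̃)`, radius `ρ`, overlap `(cr, cc)` of
`E(F_{J′})·S(F̃)`, truncation `N₀ ≥ 2`); a track-blind tail majorant `Nt ≥ 0`, `Nt 0 = 0`, `ε·klTowerMeasLev … (2m) 0 ≤ Nt m`; a first-order majorant `NF`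
with `27^c·ε·(c = 0 ? klTowerMeasLev (2m) 0 : klTowerMeasLev (2m) (c+1)) ≤ NF m` for the two levels `F ≤ c + 1`, `c ≤ F` (`F := levelCount Ωe`); degree cap
`D`; `τ ≥ (e³κ)², (e²(κ+ρ))²`; `ψ ≥ κ⁻², ρ⁻²`; kit guard `e·9α/κ²·towerV D τ Nt < 1`.  Then
`klLevNormOf … J′ (2(q+1)) Δ_k Ωe ≤ ε^{2q+1}·(cr·cc^{2q+1}·(27^F·(((1/2)^{dk−1})^{lumps F}·S + T)) + cr·cc^{2q+1}·((e²)^{q+2}/2·towerFO D κ² NF (q+1)))`. -/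
theorem klLevNormOf_klTowerIncr_le_kit_orientedF9 {β : ℝ} (hβ : 0 < β) (U μ : ℝ) (K : TrigPolyC4v) {d k J' : ℕ} (hd : 1 ≤ d)
    (hk : 1 ≤ k) (hJ' : d * k ≤ J') (hdk : 2 ≤ d * k) (hZ : hubbardEffPartitionFnCT L M β U μ 0 K (klScale klE0 (d * k)) ≠ 0)
    {κ : ℝ} (hκ : 0 < κ)
    (hGB : IsGramBoundedR ((sectorSubMatrix L M β (bgmFatMultiplier L M klE0 β (nambuXiCT L μ K) (d * k - 1))).transpose *
      hubbardCovSliceCT L M β μ 0 K (klScale klE0 (d * (k + 1))) (klScale klE0 (d * k)) *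
        sectorSubMatrix L M β (bgmFatMultiplier L M klE0 β (nambuXiCT L μ K) (d * k - 1))) κ)
    {α : ℝ} (hα : 0 < α)
    (hrow : ∀ X, ∑ Y, ‖((sectorSubMatrix L M β (bgmFatMultiplier L M klE0 β (nambuXiCT L μ K) (d * k - 1))).transpose *
        hubbardCovSliceCT L M β μ 0 K (klScale klE0 (d * (k + 1))) (klScale klE0 (d * k)) *
          sectorSubMatrix L M β (bgmFatMultiplier L M klE0 β (nambuXiCT L μ K) (d * k - 1))) X Y‖ ≤ α)
    (hcol : ∀ Y, ∑ X, ‖((sectorSubMatrix L M β (bgmFatMultiplier L M klE0 β (nambuXiCT L μ K) (d * k - 1))).transpose *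
        hubbardCovSliceCT L M β μ 0 K (klScale klE0 (d * (k + 1))) (klScale klE0 (d * k)) *
          sectorSubMatrix L M β (bgmFatMultiplier L M klE0 β (nambuXiCT L μ K) (d * k - 1))) X Y‖ ≤ α)
    {ρ : ℝ} (hρ : 0 < ρ)
    {cr cc : ℝ} (hcr0 : 0 ≤ cr) (hcc0 : 0 ≤ cc)
    (hrow' : ∀ X'', ∑ X', ‖(sectorAnalysisMatrix L M β (klAnisoFamily L M β μ K klE0 J') *
        sectorSubMatrix L M β (bgmFatMultiplier L M klE0 β (nambuXiCT L μ K) (d * k - 1))) X'' X'‖ ≤ cr)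
    (hcol' : ∀ X', ∑ X'', ‖(sectorAnalysisMatrix L M β (klAnisoFamily L M β μ K klE0 J') *
        sectorSubMatrix L M β (bgmFatMultiplier L M klE0 β (nambuXiCT L μ K) (d * k - 1))) X'' X'‖ ≤ cc)
    {N₀ : ℕ} (hN₀ : 2 ≤ N₀)
    (q : ℕ) (Ωe : Fin (2 * q + 1 + 1) → Option (SectorLeg (sectorCount J')))
    {Nt : ℕ → ℝ} (hNt0 : ∀ m, 0 ≤ Nt m) (hNt00 : Nt 0 = 0)
    (hNtB : ∀ m, imagTimeWeight β M * klTowerMeasLev L M β U μ K d k (2 * m) 0 ≤ Nt m)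
    {NF : ℕ → ℝ} (hNF : ∀ m c, levelCount Ωe ≤ c + 1 → c ≤ levelCount Ωe →
      (27 : ℝ) ^ c * (imagTimeWeight β M *
        (if c = 0 then klTowerMeasLev L M β U μ K d k (2 * m) 0 else klTowerMeasLev L M β U μ K d k (2 * m) (c + 1))) ≤ NF m)
    {D : ℕ} (hD : Fintype.card (SpaceTimeIdx L M × SectorLeg (sectorCount (d * k - 1))) / 2 ≤ D)
    {τ ψ : ℝ} (hτ1 : (exp 3 * κ) ^ 2 ≤ τ) (hτ2 : (exp 2 * (κ + ρ)) ^ 2 ≤ τ) (hψ1 : κ⁻¹ ^ 2 ≤ ψ) (hψ2 : ρ⁻¹ ^ 2 ≤ ψ)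
    (hguard : exp 1 * (9 * α) / κ ^ 2 * towerV D τ Nt < 1) :
    klLevNormOf L M β μ K J' (2 * q + 1 + 1) (klTowerIncr L M β U μ K d k) Ωe ≤
      imagTimeWeight β M ^ (2 * q + 1) *
        (cr * cc ^ (2 * q + 1) * ((27 : ℝ) ^ levelCount Ωe *
            (((1 / 2 : ℝ) ^ (d * k - 1)) ^ lumps (levelCount Ωe) *
                ∑ n ∈ Icc 2 (N₀ - 1), exp 1 * (exp 1 * (9 * α) / κ ^ 2) ^ (n - 1) * ψ ^ (q + 1) *
                  towerS D τ (fun m : ℕ => imagTimeWeight β M * klTowerMuLevF L M β U μ K d k m * klLevUnitF β M 0 m (d * k - 1) / 27) n (q + 1) +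
              ψ ^ (q + 1) * (exp 1 * towerV D τ Nt * (exp 1 * (9 * α) / κ ^ 2 * towerV D τ Nt) ^ (N₀ - 1) /
                (1 - exp 1 * (9 * α) / κ ^ 2 * towerV D τ Nt)))) +
          cr * cc ^ (2 * q + 1) * (exp 2 ^ (q + 2) / 2 * towerFO D (κ ^ 2) NF (q + 1))) := by
  have hε : 0 ≤ imagTimeWeight β M := imagTimeWeight_nonneg hβ.le M
  have h9 : (((9 : ℕ) : ℝ)) = 9 := by norm_num
  have h9α : α ≤ ((9 : ℕ) : ℝ) * α := by rw [h9]; linarith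
  have hτ0 : 0 ≤ τ := le_trans (by positivity) hτ1
  -- the full-pin family of the re-keyed instance and its rows
  set B : ℕ → ℕ → ℝ := fun m c => if c = 0 then klTowerMeasLev L M β U μ K d k (2 * m) 0
    else klTowerMeasLev L M β U μ K d k (2 * m) (c + 1) with hB
  have hB0 : ∀ m c, 0 ≤ B m c := fun m c => by
    rw [hB]; dsimp only; split_ifs <;> exact klTowerMeasLev_nonneg hβ.le U μ K d k _ _
  have hBz : ∀ m, B m 0 = klTowerMeasLev L M β U μ K d k (2 * m) 0 := fun m => by rw [hB]; exact if_pos rfl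
  have hNtB' : ∀ m, imagTimeWeight β M * B m 0 ≤ Nt m := fun m => by rw [hBz]; exact hNtB m
  have hNF' : ∀ m c, levelCount Ωe ≤ c + 1 → c ≤ levelCount Ωe → (27 : ℝ) ^ c * (imagTimeWeight β M * B m c) ≤ NF m :=
    fun m c h1 h2 => hNF m c h1 h2
  -- the door guard from the kit guard
  have hnV : normV (SpaceTimeIdx L M × SectorLeg (sectorCount (d * k - 1))) κ ρ (fun m' => imagTimeWeight β M * B m' 0) ≤ towerV D τ Nt :=
    (normV_mono hκ.le hρ.le hNtB').trans
      ((normV_le_towerV hκ.le hρ.le hNt0 hNt00 hD).trans (towerV_mono (by positivity) hτ2 hNt0 fun _ => le_rfl))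
  have hθV : Real.exp 1 * α * normV (SpaceTimeIdx L M × SectorLeg (sectorCount (d * k - 1))) κ ρ
      (fun m' => imagTimeWeight β M * klTowerMeasLev L M β U μ K d k (2 * m') 0) / κ ^ 2 < 1 := by
    have hn0 : 0 ≤ normV (SpaceTimeIdx L M × SectorLeg (sectorCount (d * k - 1))) κ ρ (fun m' => imagTimeWeight β M * B m' 0) :=
      normV_nonneg hκ.le hρ.le fun m' => mul_nonneg hε (hB0 _ _)
    have hV0 : 0 ≤ towerV D τ Nt := towerV_nonneg (D := D) hτ0 hNt0
    have hfun : (fun m' => imagTimeWeight β M * klTowerMeasLev L M β U μ K d k (2 * m') 0) =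
        fun m' => imagTimeWeight β M * B m' 0 := funext fun m' => by rw [hBz]
    rw [hfun]
    calc Real.exp 1 * α * normV (SpaceTimeIdx L M × SectorLeg (sectorCount (d * k - 1))) κ ρ
          (fun m' => imagTimeWeight β M * B m' 0) / κ ^ 2
        = exp 1 / κ ^ 2 * (α * normV (SpaceTimeIdx L M × SectorLeg (sectorCount (d * k - 1))) κ ρ
            (fun m' => imagTimeWeight β M * B m' 0)) := by ring
      _ ≤ exp 1 / κ ^ 2 * ((9 * α) * towerV D τ Nt) :=
          mul_le_mul_of_nonneg_left (mul_le_mul (by linarith) hnV hn0 (by positivity)) (by positivity)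
      _ = exp 1 * (9 * α) / κ ^ 2 * towerV D τ Nt := by ring
      _ < 1 := hguard
  have hguard' : exp 1 * (((9 : ℕ) : ℝ) * α) / κ ^ 2 * towerV D τ Nt < 1 := by rw [h9]; exact hguard
  -- the generic kit composition on k3c2-p3's pin-credited door form
  have h := klLevNormOf_le_kit_oriented_of_doorForm_at (L := L) (M := M) hβ.le μ K (J' := J') (n₁ := d * k - 1) (by omega)
    (klTowerIncr L M β U μ K d k) hκ hρ hα.le h9α hcr0 hcc0 hN₀ (B := B) hB0
    (Bm := fun m : ℕ => imagTimeWeight β M * klTowerMuLevF L M β U μ K d k m * klLevUnitF β M 0 m (d * k - 1) / 27)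
    (fun m => towerBmF_nonneg hβ U μ K d k m) (towerBmF_zero β U μ K d k)
    (θ := (1 / 2 : ℝ) ^ (d * k - 1)) (by positivity) (pow_le_one₀ (by norm_num) (by norm_num))
    Ωe hNt0 hNt00 hNtB' hNF' hD hτ1 hτ2 hψ1 hψ2 hguard'
    (fun p J hp τ'' w'' => doorSum_klTowerIncr_le_orientedF9 (L := L) (M := M) hβ U μ K hd hk hJ' hdk hZ hκ hGB hα hrow hcol hρ hcc0
      hrow' hcol' hN₀ hθV p J hp τ'' w'')
  rw [h9] at h
  exact h

/-! ## §3 The born levelled arrays in kit form, floor arrays concrete -/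

/-- **THE ORIENTED BORN LEVELLED ARRAYS OF A BLOCK INCREMENT IN KIT FORM, PIN-CREDITED, FLOOR ARRAYS CONCRETE, EVERY LEVEL** (the model half of the
`hstep` row of the floor-keyed law, before the division by the output unit).  At the born family `J′ = dk` and under the binders of
`klLevNormOf_klTowerIncr_le_kit_orientedF9` (the first-order majorant asked at the levels `F ≤ c + 1`, `c ≤ F`), for every level `F`:
`klTowerBornLev … d k (2(q+1)) F ≤ ε^{2q+1}·(cr·cc^{2q+1}·(27^F·(((1/2)^{dk−1})^{lumps F}·S + T)) + cr·cc^{2q+1}·((e²)^{q+2}/2·towerFO D κ² NF (q+1)))`. -/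
theorem klTowerBornLev_le_kit_orientedF9 {β : ℝ} (hβ : 0 < β) (U μ : ℝ) (K : TrigPolyC4v) {d k : ℕ} (hd : 1 ≤ d) (hk : 1 ≤ k)
    (hdk : 2 ≤ d * k) (hZ : hubbardEffPartitionFnCT L M β U μ 0 K (klScale klE0 (d * k)) ≠ 0)
    {κ : ℝ} (hκ : 0 < κ)
    (hGB : IsGramBoundedR ((sectorSubMatrix L M β (bgmFatMultiplier L M klE0 β (nambuXiCT L μ K) (d * k - 1))).transpose *
      hubbardCovSliceCT L M β μ 0 K (klScale klE0 (d * (k + 1))) (klScale klE0 (d * k)) *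
        sectorSubMatrix L M β (bgmFatMultiplier L M klE0 β (nambuXiCT L μ K) (d * k - 1))) κ)
    {α : ℝ} (hα : 0 < α)
    (hrow : ∀ X, ∑ Y, ‖((sectorSubMatrix L M β (bgmFatMultiplier L M klE0 β (nambuXiCT L μ K) (d * k - 1))).transpose *
        hubbardCovSliceCT L M β μ 0 K (klScale klE0 (d * (k + 1))) (klScale klE0 (d * k)) *
          sectorSubMatrix L M β (bgmFatMultiplier L M klE0 β (nambuXiCT L μ K) (d * k - 1))) X Y‖ ≤ α)
    (hcol : ∀ Y, ∑ X, ‖((sectorSubMatrix L M β (bgmFatMultiplier L M klE0 β (nambuXiCT L μ K) (d * k - 1))).transpose *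
        hubbardCovSliceCT L M β μ 0 K (klScale klE0 (d * (k + 1))) (klScale klE0 (d * k)) *
          sectorSubMatrix L M β (bgmFatMultiplier L M klE0 β (nambuXiCT L μ K) (d * k - 1))) X Y‖ ≤ α)
    {ρ : ℝ} (hρ : 0 < ρ)
    {cr cc : ℝ} (hcr0 : 0 ≤ cr) (hcc0 : 0 ≤ cc)
    (hrow' : ∀ X'', ∑ X', ‖(sectorAnalysisMatrix L M β (klAnisoFamily L M β μ K klE0 (d * k)) *
        sectorSubMatrix L M β (bgmFatMultiplier L M klE0 β (nambuXiCT L μ K) (d * k - 1))) X'' X'‖ ≤ cr)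
    (hcol' : ∀ X', ∑ X'', ‖(sectorAnalysisMatrix L M β (klAnisoFamily L M β μ K klE0 (d * k)) *
        sectorSubMatrix L M β (bgmFatMultiplier L M klE0 β (nambuXiCT L μ K) (d * k - 1))) X'' X'‖ ≤ cc)
    {N₀ : ℕ} (hN₀ : 2 ≤ N₀) (q F : ℕ)
    {Nt : ℕ → ℝ} (hNt0 : ∀ m, 0 ≤ Nt m) (hNt00 : Nt 0 = 0)
    (hNtB : ∀ m, imagTimeWeight β M * klTowerMeasLev L M β U μ K d k (2 * m) 0 ≤ Nt m)
    {NF : ℕ → ℝ} (hNF : ∀ m c, F ≤ c + 1 → c ≤ F →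
      (27 : ℝ) ^ c * (imagTimeWeight β M *
        (if c = 0 then klTowerMeasLev L M β U μ K d k (2 * m) 0 else klTowerMeasLev L M β U μ K d k (2 * m) (c + 1))) ≤ NF m)
    {D : ℕ} (hD : Fintype.card (SpaceTimeIdx L M × SectorLeg (sectorCount (d * k - 1))) / 2 ≤ D)
    {τ ψ : ℝ} (hτ1 : (exp 3 * κ) ^ 2 ≤ τ) (hτ2 : (exp 2 * (κ + ρ)) ^ 2 ≤ τ) (hψ1 : κ⁻¹ ^ 2 ≤ ψ) (hψ2 : ρ⁻¹ ^ 2 ≤ ψ)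
    (hguard : exp 1 * (9 * α) / κ ^ 2 * towerV D τ Nt < 1) :
    klTowerBornLev L M β U μ K d k (2 * (q + 1)) F ≤
      imagTimeWeight β M ^ (2 * q + 1) *
        (cr * cc ^ (2 * q + 1) * ((27 : ℝ) ^ F *
            (((1 / 2 : ℝ) ^ (d * k - 1)) ^ lumps F *
                ∑ n ∈ Icc 2 (N₀ - 1), exp 1 * (exp 1 * (9 * α) / κ ^ 2) ^ (n - 1) * ψ ^ (q + 1) *
                  towerS D τ (fun m : ℕ => imagTimeWeight β M * klTowerMuLevF L M β U μ K d k m * klLevUnitF β M 0 m (d * k - 1) / 27) n (q + 1) +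
              ψ ^ (q + 1) * (exp 1 * towerV D τ Nt * (exp 1 * (9 * α) / κ ^ 2 * towerV D τ Nt) ^ (N₀ - 1) /
                (1 - exp 1 * (9 * α) / κ ^ 2 * towerV D τ Nt)))) +
          cr * cc ^ (2 * q + 1) * (exp 2 ^ (q + 2) / 2 * towerFO D (κ ^ 2) NF (q + 1))) := by
  have hε : 0 ≤ imagTimeWeight β M := imagTimeWeight_nonneg hβ.le M
  have hτ0 : 0 ≤ τ := le_trans (by positivity) hτ1
  have hψ0 : 0 ≤ ψ := le_trans (by positivity) hψ1
  have h27 : (0 : ℝ) ≤ 27 := by norm_num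
  have hBm0 : ∀ m, 0 ≤ (fun m : ℕ => imagTimeWeight β M * klTowerMuLevF L M β U μ K d k m * klLevUnitF β M 0 m (d * k - 1) / 27) m :=
    fun m => towerBmF_nonneg hβ U μ K d k m
  have hNF0 : ∀ m, 0 ≤ NF m := fun m => by
    refine le_trans (mul_nonneg (pow_nonneg h27 F) (mul_nonneg hε ?_)) (hNF m F (by omega) le_rfl)
    split_ifs <;> exact klTowerMeasLev_nonneg hβ.le U μ K d k _ _
  have hRHS : 0 ≤ imagTimeWeight β M ^ (2 * q + 1) *
      (cr * cc ^ (2 * q + 1) * ((27 : ℝ) ^ F *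
          (((1 / 2 : ℝ) ^ (d * k - 1)) ^ lumps F *
              ∑ n ∈ Icc 2 (N₀ - 1), exp 1 * (exp 1 * (9 * α) / κ ^ 2) ^ (n - 1) * ψ ^ (q + 1) *
                towerS D τ (fun m : ℕ => imagTimeWeight β M * klTowerMuLevF L M β U μ K d k m * klLevUnitF β M 0 m (d * k - 1) / 27) n (q + 1) +
            ψ ^ (q + 1) * (exp 1 * towerV D τ Nt * (exp 1 * (9 * α) / κ ^ 2 * towerV D τ Nt) ^ (N₀ - 1) /
              (1 - exp 1 * (9 * α) / κ ^ 2 * towerV D τ Nt)))) +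
        cr * cc ^ (2 * q + 1) * (exp 2 ^ (q + 2) / 2 * towerFO D (κ ^ 2) NF (q + 1))) := by
    have hFO0 : 0 ≤ towerFO D (κ ^ 2) NF (q + 1) := towerFO_nonneg (by positivity) hNF0 _
    have hS0 : 0 ≤ ∑ n ∈ Icc 2 (N₀ - 1), exp 1 * (exp 1 * (9 * α) / κ ^ 2) ^ (n - 1) * ψ ^ (q + 1) *
        towerS D τ (fun m : ℕ => imagTimeWeight β M * klTowerMuLevF L M β U μ K d k m * klLevUnitF β M 0 m (d * k - 1) / 27) n (q + 1) :=
      sum_nonneg fun n _ => by have := towerS_nonneg (D := D) hτ0 hBm0 n (q + 1); positivity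
    have hT0 : 0 ≤ ψ ^ (q + 1) * (exp 1 * towerV D τ Nt * (exp 1 * (9 * α) / κ ^ 2 * towerV D τ Nt) ^ (N₀ - 1) /
        (1 - exp 1 * (9 * α) / κ ^ 2 * towerV D τ Nt)) := by
      have hV := towerV_nonneg (D := D) hτ0 hNt0
      exact mul_nonneg (pow_nonneg hψ0 _) (div_nonneg (by positivity) (sub_nonneg.2 hguard.le))
    positivity
  unfold klTowerBornLev
  rcases isEmpty_or_nonempty {Ωe : Fin (2 * (q + 1)) → Option (SectorLeg (sectorCount (d * k))) // levelCount Ωe = F} with h | h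
  · rw [Real.iSup_of_isEmpty]; exact hRHS
  · refine ciSup_le fun Ωe => ?_
    have h1 := klLevNormOf_klTowerIncr_le_kit_orientedF9 (L := L) (M := M) hβ U μ K hd hk le_rfl hdk hZ hκ hGB hα hrow hcol hρ hcr0 hcc0
      hrow' hcol' hN₀ q Ωe.1 hNt0 hNt00 hNtB (NF := NF) (fun m c h1 h2 => hNF m c (by rw [← Ωe.2]; exact h1) (by rw [← Ωe.2]; exact h2))
      hD hτ1 hτ2 hψ1 hψ2 hguard
    rw [Ωe.2] at h1
    exact h1


/-! ## §4 One majorant for all three kit functionals (the law's `N_k` shape) -/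

/-- **THE ORIENTED BORN LEVELLED ARRAYS IN KIT FORM WITH A SINGLE MAJORANT** (the shape of the floor-keyed law's `hstep`, which runs `towerFO`,
`towerS`, `towerV` on ONE array `N_k`).  Under the binders of `klTowerBornLev_le_kit_orientedF9` with `Nt := N`, `NF := N` and the graded floor array
dominated too (`ε·klTowerMuLevF … m·klLevUnitF β M 0 m (dk−1)/27 ≤ N m`), for every level `F`:
`klTowerBornLev … d k (2(q+1)) F ≤ ε^{2q+1}·(cr·cc^{2q+1}·(27^F·(((1/2)^{dk−1})^{lumps F}·S(N) + T(N))) + cr·cc^{2q+1}·((e²)^{q+2}/2·towerFO D κ² N (q+1)))`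
(`towerS_mono`). -/
theorem klTowerBornLev_le_kit_orientedF9_merged {β : ℝ} (hβ : 0 < β) (U μ : ℝ) (K : TrigPolyC4v) {d k : ℕ} (hd : 1 ≤ d) (hk : 1 ≤ k)
    (hdk : 2 ≤ d * k) (hZ : hubbardEffPartitionFnCT L M β U μ 0 K (klScale klE0 (d * k)) ≠ 0)
    {κ : ℝ} (hκ : 0 < κ)
    (hGB : IsGramBoundedR ((sectorSubMatrix L M β (bgmFatMultiplier L M klE0 β (nambuXiCT L μ K) (d * k - 1))).transpose *
      hubbardCovSliceCT L M β μ 0 K (klScale klE0 (d * (k + 1))) (klScale klE0 (d * k)) *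
        sectorSubMatrix L M β (bgmFatMultiplier L M klE0 β (nambuXiCT L μ K) (d * k - 1))) κ)
    {α : ℝ} (hα : 0 < α)
    (hrow : ∀ X, ∑ Y, ‖((sectorSubMatrix L M β (bgmFatMultiplier L M klE0 β (nambuXiCT L μ K) (d * k - 1))).transpose *
        hubbardCovSliceCT L M β μ 0 K (klScale klE0 (d * (k + 1))) (klScale klE0 (d * k)) *
          sectorSubMatrix L M β (bgmFatMultiplier L M klE0 β (nambuXiCT L μ K) (d * k - 1))) X Y‖ ≤ α)
    (hcol : ∀ Y, ∑ X, ‖((sectorSubMatrix L M β (bgmFatMultiplier L M klE0 β (nambuXiCT L μ K) (d * k - 1))).transpose *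
        hubbardCovSliceCT L M β μ 0 K (klScale klE0 (d * (k + 1))) (klScale klE0 (d * k)) *
          sectorSubMatrix L M β (bgmFatMultiplier L M klE0 β (nambuXiCT L μ K) (d * k - 1))) X Y‖ ≤ α)
    {ρ : ℝ} (hρ : 0 < ρ)
    {cr cc : ℝ} (hcr0 : 0 ≤ cr) (hcc0 : 0 ≤ cc)
    (hrow' : ∀ X'', ∑ X', ‖(sectorAnalysisMatrix L M β (klAnisoFamily L M β μ K klE0 (d * k)) *
        sectorSubMatrix L M β (bgmFatMultiplier L M klE0 β (nambuXiCT L μ K) (d * k - 1))) X'' X'‖ ≤ cr)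
    (hcol' : ∀ X', ∑ X'', ‖(sectorAnalysisMatrix L M β (klAnisoFamily L M β μ K klE0 (d * k)) *
        sectorSubMatrix L M β (bgmFatMultiplier L M klE0 β (nambuXiCT L μ K) (d * k - 1))) X'' X'‖ ≤ cc)
    {N₀ : ℕ} (hN₀ : 2 ≤ N₀) (q F : ℕ)
    {N : ℕ → ℝ} (hN0 : ∀ m, 0 ≤ N m) (hN00 : N 0 = 0)
    (hBmN : ∀ m, imagTimeWeight β M * klTowerMuLevF L M β U μ K d k m * klLevUnitF β M 0 m (d * k - 1) / 27 ≤ N m)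
    (hNt : ∀ m, imagTimeWeight β M * klTowerMeasLev L M β U μ K d k (2 * m) 0 ≤ N m)
    (hNF : ∀ m c, F ≤ c + 1 → c ≤ F →
      (27 : ℝ) ^ c * (imagTimeWeight β M *
        (if c = 0 then klTowerMeasLev L M β U μ K d k (2 * m) 0 else klTowerMeasLev L M β U μ K d k (2 * m) (c + 1))) ≤ N m)
    {D : ℕ} (hD : Fintype.card (SpaceTimeIdx L M × SectorLeg (sectorCount (d * k - 1))) / 2 ≤ D)
    {τ ψ : ℝ} (hτ1 : (exp 3 * κ) ^ 2 ≤ τ) (hτ2 : (exp 2 * (κ + ρ)) ^ 2 ≤ τ) (hψ1 : κ⁻¹ ^ 2 ≤ ψ) (hψ2 : ρ⁻¹ ^ 2 ≤ ψ)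
    (hguard : exp 1 * (9 * α) / κ ^ 2 * towerV D τ N < 1) :
    klTowerBornLev L M β U μ K d k (2 * (q + 1)) F ≤
      imagTimeWeight β M ^ (2 * q + 1) *
        (cr * cc ^ (2 * q + 1) * ((27 : ℝ) ^ F *
            (((1 / 2 : ℝ) ^ (d * k - 1)) ^ lumps F *
                ∑ n ∈ Icc 2 (N₀ - 1), exp 1 * (exp 1 * (9 * α) / κ ^ 2) ^ (n - 1) * ψ ^ (q + 1) * towerS D τ N n (q + 1) +
              ψ ^ (q + 1) * (exp 1 * towerV D τ N * (exp 1 * (9 * α) / κ ^ 2 * towerV D τ N) ^ (N₀ - 1) /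
                (1 - exp 1 * (9 * α) / κ ^ 2 * towerV D τ N)))) +
          cr * cc ^ (2 * q + 1) * (exp 2 ^ (q + 2) / 2 * towerFO D (κ ^ 2) N (q + 1))) := by
  have hε : 0 ≤ imagTimeWeight β M := imagTimeWeight_nonneg hβ.le M
  have hτ0 : 0 ≤ τ := le_trans (by positivity) hτ1
  have hψ0 : 0 ≤ ψ := le_trans (by positivity) hψ1
  have h := klTowerBornLev_le_kit_orientedF9 (L := L) (M := M) hβ U μ K hd hk hdk hZ hκ hGB hα hrow hcol hρ hcr0 hcc0 hrow' hcol' hN₀ q F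
    hN0 hN00 hNt (NF := N) hNF hD hτ1 hτ2 hψ1 hψ2 hguard
  refine h.trans (mul_le_mul_of_nonneg_left (add_le_add (mul_le_mul_of_nonneg_left (mul_le_mul_of_nonneg_left
    (add_le_add (mul_le_mul_of_nonneg_left (sum_le_sum fun n _ => mul_le_mul_of_nonneg_left
      (towerS_mono hτ0 le_rfl (fun m => towerBmF_nonneg hβ U μ K d k m) hBmN) (by positivity)) (by positivity)) le_rfl)
    (by positivity)) (by positivity)) le_rfl) (pow_nonneg hε _))

end Born

end Summit.HubbardSuperconductivity.HubbardSuperconductivity.Theorems.EngineV8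

end
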